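import Literature.Probability.FitznerVanDerHofstad2017.SrwTwistProductWeight
import Literature.Probability.FitznerVanDerHofstad2017.SrwTwistTruncationSeeds
import HarnessLib

/-!
# Coefficient perturbation of PRODUCT row objects costs the origin seed

The weighted slices of a twisted-seed kernel (Fitzner–van der Hofstad, *NoBLE* §5.1.1) evaluate
`u`-integrals of PRODUCTS over the coordinates of truncated one-dimensional rows,
`Obj(R) = (n!)⁻¹ (∫₀^∞ τⁿ e^{-τ} Re Π_μ R_μ(τ) dτ)/(2π)^d`, whose rows
`R_μ(τ) = Σ_{j≤J} ε_j W^{(a_μ)}_j(τ/d) c_{μ,j}` carry transcendental coefficients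
`c_{μ,j} = 2π iʲ J_j(β/d)` (`SrwTwistCosPowRow`, `SrwTwistTruncationSeeds`).  A kernel wants to carry
EXACT `ℚ[i]` literals `c'_{μ,j}` instead.  This file proves, `d`-generically and number-free, that
the substitution costs a multiple of the ORIGIN SEED `srwI d (n+1) 0 0`:

* `abs_prodRowObj_sub_prodRowObj_le` — the ABSTRACT statement: for continuous rows with
  `‖R'_μ(τ)‖ ≤ α'_μ I_0(τ/d)` and `‖R_μ(τ) − R'_μ(τ)‖ ≤ η_μ I_0(τ/d)` (`τ > 0`),
  `|Obj(R) − Obj(R')| ≤ (Π_μ(α'_μ+η_μ) − Π_μ α'_μ)/(2π)^d · srwI d (n+1) 0 0` (`d ≥ 2n+3`) — the product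
  perturbation inequality `abs_re_prod_add_sub_re_prod_le` (`SrwTwistProductWeight`), monotonicity of
  `Π(x_μ+ρ_μ) − Π x_μ`, and `e^{-τ} I_0(τ/d)^d = Π_μ q_{τ/d}(0)`;
* `abs_prodCosPowRowObj_sub_le_incr_mul_srwI_zero` — the instance for cosine-power rows with two
  coefficient tables `c, c' : Fin d → ℕ → ℂ`: `α'_μ = Σ_{j≤J} ε_j‖c'_{μ,j}‖`, `η_μ = Σ_{j≤J} ε_j‖c_{μ,j} − c'_{μ,j}‖`
  (the shifted weights satisfy `|W^{(a)}_j(v)| ≤ I_0(v)`, `norm_cosPowWeight_le_besselI_zero`) — the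
  product analogue of `abs_rowObj_sub_rowObj_le_incr_mul_srwI_zero`.

Everything is PROVED (standard axioms), `d`-generic and number-free; no definition, no named fact.
Epistemic status / lane: what-if / input-certification SUPPORT; nothing here is a certificate; no
statement at a specific dimension.

## References
* R. Fitzner, R. van der Hofstad, PTRF 169 (2017) 1041–1119, (3.34)–(3.36) p. 1071, §5.1.1 (5.2)–(5.5),
  §5.2 (5.9), (5.14) p. 1092. [FitznerVanDerHofstad2016NoBLE]
* NIST DLMF §10.35.2, §10.37, §10.14.4. [DLMF]
-/

noncomputable section

open MeasureTheory Set Filter Real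
open scoped Topology Nat

namespace Literature.Probability.FitznerVanDerHofstad2017

open Literature.Barriers.CriticalPhenomena
open Literature.Probability.LatticeModels (besselI besselI_nonneg besselI_le_of_natAbs_le srwHeatKernel
  continuous_srwHeatKernel_left)

variable {d : ℕ}

/-! ### Two elementary inequalities -/

/-- Monotonicity of the product increment in the base point:
`Π(x_i+ρ_i) − Π x_i ≤ Π(α_i+ρ_i) − Π α_i` for `0 ≤ x_i ≤ α_i`, `0 ≤ ρ_i`. [folklore] -/
private theorem prod_add_sub_prod_le_of_le {ι : Type*} (s : Finset ι) (x α ρ : ι → ℝ)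
    (hx0 : ∀ i ∈ s, 0 ≤ x i) (hxα : ∀ i ∈ s, x i ≤ α i) (hρ : ∀ i ∈ s, 0 ≤ ρ i) :
    ∏ i ∈ s, (x i + ρ i) - ∏ i ∈ s, x i ≤ ∏ i ∈ s, (α i + ρ i) - ∏ i ∈ s, α i := by
  classical
  induction s using Finset.induction_on with
  | empty => simp
  | insert j s hj ih =>
    have hx0' : ∀ i ∈ s, 0 ≤ x i := fun i hi => hx0 i (Finset.mem_insert_of_mem hi)
    have hxα' : ∀ i ∈ s, x i ≤ α i := fun i hi => hxα i (Finset.mem_insert_of_mem hi)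
    have hρ' : ∀ i ∈ s, 0 ≤ ρ i := fun i hi => hρ i (Finset.mem_insert_of_mem hi)
    have ih' := ih hx0' hxα' hρ'
    have hxj0 : 0 ≤ x j := hx0 j (Finset.mem_insert_self j s)
    have hxjα : x j ≤ α j := hxα j (Finset.mem_insert_self j s)
    have hρj : 0 ≤ ρ j := hρ j (Finset.mem_insert_self j s)
    rw [Finset.prod_insert hj, Finset.prod_insert hj, Finset.prod_insert hj, Finset.prod_insert hj]
    set Pp := ∏ i ∈ s, (x i + ρ i) with hPp
    set P0 := ∏ i ∈ s, x i with hP0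
    set Ap := ∏ i ∈ s, (α i + ρ i) with hAp
    set A0 := ∏ i ∈ s, α i with hA0
    have hP0P : P0 ≤ Pp := Finset.prod_le_prod hx0' (fun i hi => by linarith [hρ' i hi])
    have hPpA : Pp ≤ Ap :=
      Finset.prod_le_prod (fun i hi => by linarith [hx0' i hi, hρ' i hi])
        (fun i hi => by linarith [hxα' i hi])
    have hD0 : 0 ≤ Ap - A0 := (sub_nonneg.2 hP0P).trans ih'
    have e1 : x j * (Pp - P0) ≤ α j * (Ap - A0) :=
      (mul_le_mul_of_nonneg_left ih' hxj0).trans (mul_le_mul_of_nonneg_right hxjα hD0)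
    have e2 : ρ j * Pp ≤ ρ j * Ap := mul_le_mul_of_nonneg_left hPpA hρj
    calc (x j + ρ j) * Pp - x j * P0 = x j * (Pp - P0) + ρ j * Pp := by ring
      _ ≤ α j * (Ap - A0) + ρ j * Ap := add_le_add e1 e2
      _ = (α j + ρ j) * Ap - α j * A0 := by ring

/-- `Σ_{s≤a} C(a,s)/2^a = 1`. [folklore] -/
private theorem sum_choose_div_two_pow (a : ℕ) :
    ∑ s ∈ Finset.range (a + 1), (a.choose s : ℝ) / 2 ^ a = 1 := by
  rw [← Finset.sum_div]
  have h : (∑ s ∈ Finset.range (a + 1), (a.choose s : ℝ)) = 2 ^ a := by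
    exact_mod_cast Nat.sum_range_choose a
  rw [h, div_self (pow_ne_zero _ two_ne_zero)]

/-! ### The shifted cosine-power weights are dominated by `I_0` -/

/-- `|W^{(a)}_j(v)| = |2^{-a} Σ_s C(a,s) I_{jm−(2s−a)}(v)| ≤ I_0(v)` for `v ≥ 0` (`0 ≤ I_k ≤ I_0`,
coefficient 1-norm `1`). [cite: DLMF, 10.37; FitznerVanDerHofstad2016NoBLE, §5.1.1 (5.2)–(5.4)] -/
theorem norm_cosPowWeight_le_besselI_zero (a : ℕ) {v : ℝ} (hv : 0 ≤ v) (m j : ℤ) :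
    ‖∑ s ∈ Finset.range (a + 1),
        ((a.choose s : ℂ) / 2 ^ a) * (besselI (j * m - ((2 * (s : ℤ) - a : ℤ))) v : ℂ)‖
      ≤ besselI 0 v := by
  refine (norm_sum_le _ _).trans ?_
  calc ∑ s ∈ Finset.range (a + 1),
        ‖((a.choose s : ℂ) / 2 ^ a) * (besselI (j * m - ((2 * (s : ℤ) - a : ℤ))) v : ℂ)‖
      ≤ ∑ s ∈ Finset.range (a + 1), (a.choose s : ℝ) / 2 ^ a * besselI 0 v := by
        refine Finset.sum_le_sum fun s _ => ?_
        rw [norm_mul, Complex.norm_real, Real.norm_eq_abs,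
          abs_of_nonneg (besselI_nonneg hv _)]
        have hc : ‖((a.choose s : ℂ) / 2 ^ a)‖ = (a.choose s : ℝ) / 2 ^ a := by
          rw [norm_div, norm_pow]; simp
        rw [hc]
        exact mul_le_mul_of_nonneg_left (besselI_le_of_natAbs_le hv (by simp)) (by positivity)
    _ = besselI 0 v := by rw [← Finset.sum_mul, sum_choose_div_two_pow, one_mul]

/-! ### The abstract product-row perturbation theorem -/

/-- **Coefficient perturbation of a PRODUCT row object costs the origin seed.** For `d ≥ 2n+3` and
continuous rows `R_μ, R'_μ : ℝ → ℂ` with `‖R'_μ(τ)‖ ≤ α'_μ I_0(τ/d)` and `‖R_μ(τ) − R'_μ(τ)‖ ≤ η_μ I_0(τ/d)`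
for `τ > 0` (`α'_μ, η_μ ≥ 0`):
`|(n!)⁻¹(∫₀^∞ τⁿe^{-τ} Re Π_μ R_μ)/(2π)^d − (n!)⁻¹(∫₀^∞ τⁿe^{-τ} Re Π_μ R'_μ)/(2π)^d|`
`≤ (Π_μ(α'_μ+η_μ) − Π_μ α'_μ)/(2π)^d · srwI d (n+1) 0 0`.
[cite: FitznerVanDerHofstad2016NoBLE, (3.34)–(3.36) p. 1071, §5.1.1 (5.2)–(5.5); DLMF, 10.35.2] -/
theorem abs_prodRowObj_sub_prodRowObj_le (n : ℕ) (hd : 2 * (n + 1) + 1 ≤ d) (R R' : Fin d → ℝ → ℂ)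
    (hR : ∀ μ, Continuous (R μ)) (hR' : ∀ μ, Continuous (R' μ)) (α' η : Fin d → ℝ)
    (hα' : ∀ μ, 0 ≤ α' μ) (hη : ∀ μ, 0 ≤ η μ)
    (hb' : ∀ μ (τ : ℝ), 0 < τ → ‖R' μ τ‖ ≤ α' μ * besselI 0 (τ / d))
    (hb : ∀ μ (τ : ℝ), 0 < τ → ‖R μ τ - R' μ τ‖ ≤ η μ * besselI 0 (τ / d)) :
    |(n ! : ℝ)⁻¹ * (∫ τ in Ioi (0:ℝ), τ ^ n * (Real.exp (-τ) * (∏ μ, R μ τ).re)) / (2 * π) ^ d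
      - (n ! : ℝ)⁻¹ * (∫ τ in Ioi (0:ℝ), τ ^ n * (Real.exp (-τ) * (∏ μ, R' μ τ).re)) / (2 * π) ^ d|
    ≤ ((∏ μ, (α' μ + η μ)) - ∏ μ, α' μ) / (2 * π) ^ d * srwI d (n + 1) 0 (fun _ : Fin d => 0) := by
  have hd1 : 1 ≤ d := by omega
  have hd3 : 2 * n + 3 ≤ d := by omega
  have hd0 : (0 : ℝ) < d := by exact_mod_cast (by omega : 0 < d)
  have hπ : (0 : ℝ) < π := Real.pi_pos
  have hn0 : (n ! : ℝ) ≠ 0 := by positivity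
  set K : ℝ := (∏ μ, (α' μ + η μ)) - ∏ μ, α' μ with hK
  set f : ℝ → ℝ := fun τ => τ ^ n * (Real.exp (-τ) * (∏ μ, R μ τ).re) with hf
  set g : ℝ → ℝ := fun τ => τ ^ n * (Real.exp (-τ) * (∏ μ, R' μ τ).re) with hg
  set h : ℝ → ℝ := fun τ => K * (τ ^ n * ∏ μ : Fin d, srwHeatKernel (τ / d) ((fun _ : Fin d => (0:ℤ)) μ))
    with hh
  -- e^{-τ} I_0(τ/d)^d = Π_μ q_{τ/d}(0)
  have hq : ∀ τ : ℝ, Real.exp (-τ) * besselI 0 (τ / d) ^ d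
      = ∏ μ : Fin d, srwHeatKernel (τ / d) ((fun _ : Fin d => (0:ℤ)) μ) := by
    intro τ
    have := exp_neg_mul_besselI_pow_mul_pow_eq_prod_srwHeatKernel hd1 (Nat.zero_le d) 0 τ
    rw [pow_zero, one_mul, Nat.sub_zero] at this
    rw [this]
    exact Finset.prod_congr rfl fun μ _ => by simp
  -- pointwise: |f − g| ≤ h on (0,∞)
  have hfg_le : ∀ τ : ℝ, 0 < τ → ‖f τ - g τ‖ ≤ h τ := by
    intro τ hτ
    have hv : 0 ≤ τ / d := by positivity
    have hI0 : 0 ≤ besselI 0 (τ / d) := besselI_nonneg hv 0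
    have hre : |(∏ μ, R μ τ).re - (∏ μ, R' μ τ).re| ≤ K * besselI 0 (τ / d) ^ d := by
      have h1 := abs_re_prod_add_sub_re_prod_le Finset.univ (fun μ => R' μ τ)
        (fun μ => R μ τ - R' μ τ) (fun μ => η μ * besselI 0 (τ / d)) (fun μ _ => hb μ τ hτ)
      simp only [add_sub_cancel] at h1
      refine h1.trans ?_
      have h2 := prod_add_sub_prod_le_of_le Finset.univ (fun μ => ‖R' μ τ‖)
        (fun μ => α' μ * besselI 0 (τ / d)) (fun μ => η μ * besselI 0 (τ / d))
        (fun μ _ => norm_nonneg _) (fun μ _ => hb' μ τ hτ) (fun μ _ => mul_nonneg (hη μ) hI0)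
      refine h2.trans (le_of_eq ?_)
      have e1 : ∏ μ, (α' μ * besselI 0 (τ / d) + η μ * besselI 0 (τ / d))
          = (∏ μ, (α' μ + η μ)) * besselI 0 (τ / d) ^ d := by
        have e0 : ∀ μ ∈ (Finset.univ : Finset (Fin d)),
            α' μ * besselI 0 (τ / d) + η μ * besselI 0 (τ / d) = (α' μ + η μ) * besselI 0 (τ / d) :=
          fun μ _ => by ring
        rw [Finset.prod_congr rfl e0, Finset.prod_mul_distrib, Finset.prod_const, Finset.card_univ,
          Fintype.card_fin]
      have e2 : ∏ μ : Fin d, (α' μ * besselI 0 (τ / d)) = (∏ μ, α' μ) * besselI 0 (τ / d) ^ d := by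
        rw [Finset.prod_mul_distrib, Finset.prod_const, Finset.card_univ, Fintype.card_fin]
      rw [e1, e2, hK]
      ring
    have e1 : f τ - g τ = τ ^ n * Real.exp (-τ) * ((∏ μ, R μ τ).re - (∏ μ, R' μ τ).re) := by
      simp only [hf, hg]; ring
    rw [e1, Real.norm_eq_abs, abs_mul, abs_of_nonneg (by positivity : (0:ℝ) ≤ τ ^ n * Real.exp (-τ))]
    calc τ ^ n * Real.exp (-τ) * |(∏ μ, R μ τ).re - (∏ μ, R' μ τ).re|
        ≤ τ ^ n * Real.exp (-τ) * (K * besselI 0 (τ / d) ^ d) := by gcongr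
      _ = K * (τ ^ n * (Real.exp (-τ) * besselI 0 (τ / d) ^ d)) := by ring
      _ = h τ := by rw [hq τ]
  -- integrability
  have hcont : ∀ F : Fin d → ℝ → ℂ, (∀ μ, Continuous (F μ)) →
      Continuous fun τ : ℝ => τ ^ n * (Real.exp (-τ) * (∏ μ, F μ τ).re) := fun F hF =>
    (continuous_pow n).mul ((Real.continuous_exp.comp continuous_neg).mul
      (Complex.continuous_re.comp (continuous_finsetProd _ fun μ _ => hF μ)))
  have hI0int := integrableOn_pow_mul_prod_srwHeatKernel n hd3 (fun _ : Fin d => (0:ℤ))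
  have hdom : ∀ (C : Fin d → ℝ) (F : Fin d → ℝ → ℂ), (∀ μ, 0 ≤ C μ) →
      (∀ μ (τ : ℝ), 0 < τ → ‖F μ τ‖ ≤ C μ * besselI 0 (τ / d)) →
      ∀ τ : ℝ, 0 < τ → ‖τ ^ n * (Real.exp (-τ) * (∏ μ, F μ τ).re)‖
        ≤ (∏ μ, C μ) * (τ ^ n * ∏ μ : Fin d, srwHeatKernel (τ / d) ((fun _ : Fin d => (0:ℤ)) μ)) := by
    intro C F hC hF τ hτ
    have hv : 0 ≤ τ / d := by positivity
    have hre : |(∏ μ, F μ τ).re| ≤ (∏ μ, C μ) * besselI 0 (τ / d) ^ d := by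
      calc |(∏ μ, F μ τ).re| ≤ ‖∏ μ, F μ τ‖ := Complex.abs_re_le_norm _
        _ = ∏ μ, ‖F μ τ‖ := norm_prod _ _
        _ ≤ ∏ μ, (C μ * besselI 0 (τ / d)) :=
            Finset.prod_le_prod (fun μ _ => norm_nonneg _) (fun μ _ => hF μ τ hτ)
        _ = (∏ μ, C μ) * besselI 0 (τ / d) ^ d := by
            rw [Finset.prod_mul_distrib, Finset.prod_const, Finset.card_univ, Fintype.card_fin]
    rw [norm_mul, norm_mul, Real.norm_eq_abs, Real.norm_eq_abs, Real.norm_eq_abs,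
      abs_of_nonneg (pow_nonneg hτ.le n), abs_of_pos (Real.exp_pos _)]
    calc τ ^ n * (Real.exp (-τ) * |(∏ μ, F μ τ).re|)
        ≤ τ ^ n * (Real.exp (-τ) * ((∏ μ, C μ) * besselI 0 (τ / d) ^ d)) := by gcongr
      _ = (∏ μ, C μ) * (τ ^ n * (Real.exp (-τ) * besselI 0 (τ / d) ^ d)) := by ring
      _ = (∏ μ, C μ) * (τ ^ n * ∏ μ : Fin d, srwHeatKernel (τ / d) ((fun _ : Fin d => (0:ℤ)) μ)) := by
          rw [hq τ]
  have hRb : ∀ μ (τ : ℝ), 0 < τ → ‖R μ τ‖ ≤ (α' μ + η μ) * besselI 0 (τ / d) := by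
    intro μ τ hτ
    calc ‖R μ τ‖ = ‖R' μ τ + (R μ τ - R' μ τ)‖ := by rw [add_sub_cancel]
      _ ≤ ‖R' μ τ‖ + ‖R μ τ - R' μ τ‖ := norm_add_le _ _
      _ ≤ α' μ * besselI 0 (τ / d) + η μ * besselI 0 (τ / d) := add_le_add (hb' μ τ hτ) (hb μ τ hτ)
      _ = (α' μ + η μ) * besselI 0 (τ / d) := by ring
  have hfint : Integrable f (volume.restrict (Ioi 0)) := by
    refine Integrable.mono' (hI0int.const_mul (∏ μ, (α' μ + η μ))) (hcont R hR).aestronglyMeasurable ?_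
    rw [ae_restrict_iff' measurableSet_Ioi]
    exact Eventually.of_forall fun τ hτ =>
      hdom (fun μ => α' μ + η μ) R (fun μ => add_nonneg (hα' μ) (hη μ)) hRb τ hτ
  have hgint : Integrable g (volume.restrict (Ioi 0)) := by
    refine Integrable.mono' (hI0int.const_mul (∏ μ, α' μ)) (hcont R' hR').aestronglyMeasurable ?_
    rw [ae_restrict_iff' measurableSet_Ioi]
    exact Eventually.of_forall fun τ hτ => hdom α' R' hα' hb' τ hτ
  have hhint : Integrable h (volume.restrict (Ioi 0)) := hI0int.const_mul K
  -- the integral of the majorant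
  have hh_int : ∫ τ in Ioi (0:ℝ), h τ = K * ((n ! : ℝ) * srwI d (n + 1) 0 (fun _ : Fin d => 0)) := by
    simp only [hh]
    rw [integral_const_mul]
    congr 1
    rw [srwI_succ_zero_eq_integral_prod_srwHeatKernel_div n hd3 (fun _ : Fin d => (0:ℤ))]
    field_simp
  -- assemble
  have hdiff : (n ! : ℝ)⁻¹ * (∫ τ in Ioi (0:ℝ), f τ) / (2 * π) ^ d
      - (n ! : ℝ)⁻¹ * (∫ τ in Ioi (0:ℝ), g τ) / (2 * π) ^ d
      = (n ! : ℝ)⁻¹ * (∫ τ in Ioi (0:ℝ), (f τ - g τ)) / (2 * π) ^ d := by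
    rw [integral_sub hfint hgint]
    ring
  have hnorm : ‖∫ τ in Ioi (0:ℝ), (f τ - g τ)‖ ≤ ∫ τ in Ioi (0:ℝ), h τ := by
    refine norm_integral_le_of_norm_le hhint ?_
    rw [ae_restrict_iff' measurableSet_Ioi]
    exact Eventually.of_forall fun τ hτ => hfg_le τ hτ
  show |(n ! : ℝ)⁻¹ * (∫ τ in Ioi (0:ℝ), f τ) / (2 * π) ^ d
      - (n ! : ℝ)⁻¹ * (∫ τ in Ioi (0:ℝ), g τ) / (2 * π) ^ d|
    ≤ K / (2 * π) ^ d * srwI d (n + 1) 0 (fun _ : Fin d => 0)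
  rw [hdiff, abs_div, abs_mul, abs_of_pos (by positivity : (0:ℝ) < (n ! : ℝ)⁻¹),
    abs_of_pos (by positivity : (0:ℝ) < (2 * π) ^ d), ← Real.norm_eq_abs]
  calc (n ! : ℝ)⁻¹ * ‖∫ τ in Ioi (0:ℝ), (f τ - g τ)‖ / (2 * π) ^ d
      ≤ (n ! : ℝ)⁻¹ * (∫ τ in Ioi (0:ℝ), h τ) / (2 * π) ^ d := by gcongr
    _ = K / (2 * π) ^ d * srwI d (n + 1) 0 (fun _ : Fin d => 0) := by
        rw [hh_int]
        field_simp

/-! ### The instance for cosine-power rows with literal coefficient tables -/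

/-- **Product cosine-power row objects with two coefficient tables** `c, c' : Fin d → ℕ → ℂ`
(`c_{μ,j} = 2π iʲ J_j(β/d)` in the kernel's format, `c'` exact literals):
`|Obj(c) − Obj(c')| ≤ (Π_μ(α'_μ+η_μ) − Π_μ α'_μ)/(2π)^d · srwI d (n+1) 0 0` with
`α'_μ = Σ_{j≤J} ε_j‖c'_{μ,j}‖`, `η_μ = Σ_{j≤J} ε_j‖c_{μ,j} − c'_{μ,j}‖` — the rows being
`R_μ(τ) = Σ_{j≤J} ε_j W^{(a_μ)}_j(τ/d) c_{μ,j}`, `W^{(a)}_j(v) = 2^{-a}Σ_s C(a,s) I_{jm−(2s−a)}(v)`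
(the literal shape of `SrwTwistCosPowRow.abs_srwTwist_prodCosPow_sub_rowTrunc_le_sum_srwI`).
[cite: FitznerVanDerHofstad2016NoBLE, (3.34)–(3.36) p. 1071, §5.1.1 (5.2)–(5.5); DLMF, 10.35.2, 10.37] -/
theorem abs_prodCosPowRowObj_sub_le_incr_mul_srwI_zero (n : ℕ) (hd : 2 * (n + 1) + 1 ≤ d) (m : ℤ)
    (J : ℕ) (a : Fin d → ℕ) (c c' : Fin d → ℕ → ℂ) :
    |(n ! : ℝ)⁻¹ * (∫ τ in Ioi (0:ℝ), τ ^ n * (Real.exp (-τ) *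
        (∏ μ, ∑ j ∈ Finset.range (J + 1), (if j = 0 then (1 : ℂ) else 2)
          * ((∑ s ∈ Finset.range (a μ + 1), (((a μ).choose s : ℂ) / 2 ^ (a μ))
              * (besselI (j * m - ((2 * (s : ℤ) - (a μ : ℕ) : ℤ))) (τ / d) : ℂ)) * c μ j)).re))
        / (2 * π) ^ d
      - (n ! : ℝ)⁻¹ * (∫ τ in Ioi (0:ℝ), τ ^ n * (Real.exp (-τ) *
        (∏ μ, ∑ j ∈ Finset.range (J + 1), (if j = 0 then (1 : ℂ) else 2)
          * ((∑ s ∈ Finset.range (a μ + 1), (((a μ).choose s : ℂ) / 2 ^ (a μ))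
              * (besselI (j * m - ((2 * (s : ℤ) - (a μ : ℕ) : ℤ))) (τ / d) : ℂ)) * c' μ j)).re))
        / (2 * π) ^ d|
    ≤ ((∏ μ, ((∑ j ∈ Finset.range (J + 1), (if j = 0 then (1 : ℝ) else 2) * ‖c' μ j‖)
            + ∑ j ∈ Finset.range (J + 1), (if j = 0 then (1 : ℝ) else 2) * ‖c μ j - c' μ j‖))
        - ∏ μ, ∑ j ∈ Finset.range (J + 1), (if j = 0 then (1 : ℝ) else 2) * ‖c' μ j‖) / (2 * π) ^ d
      * srwI d (n + 1) 0 (fun _ : Fin d => 0) := by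
  have hd0 : (0 : ℝ) < d := by exact_mod_cast (by omega : 0 < d)
  -- the shifted weights as functions of τ
  set W : Fin d → ℕ → ℝ → ℂ := fun μ j τ => ∑ s ∈ Finset.range (a μ + 1),
      (((a μ).choose s : ℂ) / 2 ^ (a μ)) * (besselI (j * m - ((2 * (s : ℤ) - (a μ : ℕ) : ℤ))) (τ / d) : ℂ)
    with hW
  have hcontI : ∀ b : ℤ, Continuous fun τ : ℝ => besselI b (τ / d) := by
    intro b
    have e : (fun τ : ℝ => besselI b (τ / d))
        = fun τ => Real.exp (τ / d) * srwHeatKernel (τ / d) b := by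
      ext τ
      rw [srwHeatKernel_eq_exp_neg_mul_besselI, ← mul_assoc, ← Real.exp_add, add_neg_cancel,
        Real.exp_zero, one_mul]
    rw [e]
    exact ((Real.continuous_exp.comp (continuous_id.div_const _))).mul
      ((continuous_srwHeatKernel_left b).comp (continuous_id.div_const _))
  have hWc : ∀ μ j, Continuous (W μ j) := fun μ j => by
    simp only [hW]
    exact continuous_finsetSum _ fun s _ =>
      continuous_const.mul (Complex.continuous_ofReal.comp (hcontI _))
  have hWb : ∀ μ j (τ : ℝ), 0 < τ → ‖W μ j τ‖ ≤ besselI 0 (τ / d) := fun μ j τ hτ =>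
    norm_cosPowWeight_le_besselI_zero (a μ) (by positivity) m j
  have hRc : ∀ cc : Fin d → ℕ → ℂ, ∀ μ, Continuous fun τ : ℝ =>
      ∑ j ∈ Finset.range (J + 1), (if j = 0 then (1 : ℂ) else 2) * (W μ j τ * cc μ j) := fun cc μ =>
    continuous_finsetSum _ fun j _ => continuous_const.mul ((hWc μ j).mul continuous_const)
  have hε0 : ∀ j : ℕ, (0 : ℝ) ≤ (if j = 0 then (1 : ℝ) else 2) := fun j => by split_ifs <;> norm_num
  have hεn : ∀ j : ℕ, ‖(if j = 0 then (1 : ℂ) else 2)‖ = (if j = 0 then (1 : ℝ) else 2) := fun j => by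
    split_ifs <;> simp
  have h := abs_prodRowObj_sub_prodRowObj_le n hd
    (fun μ τ => ∑ j ∈ Finset.range (J + 1), (if j = 0 then (1 : ℂ) else 2) * (W μ j τ * c μ j))
    (fun μ τ => ∑ j ∈ Finset.range (J + 1), (if j = 0 then (1 : ℂ) else 2) * (W μ j τ * c' μ j))
    (hRc c) (hRc c')
    (fun μ => ∑ j ∈ Finset.range (J + 1), (if j = 0 then (1 : ℝ) else 2) * ‖c' μ j‖)
    (fun μ => ∑ j ∈ Finset.range (J + 1), (if j = 0 then (1 : ℝ) else 2) * ‖c μ j - c' μ j‖)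
    (fun μ => Finset.sum_nonneg fun j _ => mul_nonneg (hε0 j) (norm_nonneg _))
    (fun μ => Finset.sum_nonneg fun j _ => mul_nonneg (hε0 j) (norm_nonneg _))
    (fun μ τ hτ => by
      refine (norm_sum_le _ _).trans ?_
      rw [Finset.sum_mul]
      refine Finset.sum_le_sum fun j _ => ?_
      rw [norm_mul, norm_mul, hεn]
      calc (if j = 0 then (1 : ℝ) else 2) * (‖W μ j τ‖ * ‖c' μ j‖)
          ≤ (if j = 0 then (1 : ℝ) else 2) * (besselI 0 (τ / d) * ‖c' μ j‖) := by
            gcongr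
            exact hWb μ j τ hτ
        _ = (if j = 0 then (1 : ℝ) else 2) * ‖c' μ j‖ * besselI 0 (τ / d) := by ring)
    (fun μ τ hτ => by
      rw [← Finset.sum_sub_distrib]
      refine (norm_sum_le _ _).trans ?_
      rw [Finset.sum_mul]
      refine Finset.sum_le_sum fun j _ => ?_
      rw [← mul_sub, ← mul_sub, norm_mul, norm_mul, hεn]
      calc (if j = 0 then (1 : ℝ) else 2) * (‖W μ j τ‖ * ‖c μ j - c' μ j‖)
          ≤ (if j = 0 then (1 : ℝ) else 2) * (besselI 0 (τ / d) * ‖c μ j - c' μ j‖) := by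
            gcongr
            exact hWb μ j τ hτ
        _ = (if j = 0 then (1 : ℝ) else 2) * ‖c μ j - c' μ j‖ * besselI 0 (τ / d) := by ring)
  simpa only [hW] using h

end Literature.Probability.FitznerVanDerHofstad2017
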